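import Summits.QuantumFields.YangMills.Theorems.ParabolicTrajectoryContinuumLimitOnTrajectoryJCGDefs
import Literature.MathematicalPhysics.QuantumLattice.WilsonCouplingSmoothness

/-!
# Route `ParabolicTrajectory`, crux `ContinuumLimitOnTrajectory` (stmt-QuantumFields-10522): smoothness helpers of line `jacobian-collapse-gronwall`

Helper lemmas for the ENGINE stub `stub_jacobianCollapse : JacobianCollapse` of the skeleton
`Cruxes/ContinuumLimitOnTrajectory/Lines/jacobian_collapse_gronwall.lean` (lead seat
`prover-line-stmt-QuantumFields-10522-c1-0`): the regularity fields `CollapseOn.smooth_N` (and `smooth_X` for the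
brancher) hold UNCONDITIONALLY — the time-smeared dimensionless curvature two-point function
`(D, β) ↦ N^φ_L(D, β) = Σ_{s ≤ L} D⁷ φ(s/D) ⟨P ; τ_s P⟩_{β, 2L+1}` is `C²` on `{D > 0} × ℝ` for every `C²` profile `φ`
(`contDiffOn_timeSmeared`), because each point-split correlator `β ↦ ⟨P ; τ_s P⟩_{β,2L+1}` is `C^∞` in the coupling
(`contDiff_G2`, from the Literature theorem `contDiff_covariance_wilsonMeasure`: iterated Feynman–Hellmann) and
`D ↦ D⁷ φ(s/D)` is `C²` on `D > 0`. What remains open in `JacobianCollapse` is thereby located in its QUANTITATIVE clauses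
(`deriv_ne`, `ascend`, `slope_le`, `jac_le`, `lip_le`, the ratio gap), not in regularity.
-/

set_option autoImplicit false

open MeasureTheory Filter Topology
open scoped ContDiff
open Literature.MathematicalPhysics.QuantumFieldTheory Literature.MathematicalPhysics.QuantumLattice

noncomputable section

namespace Summit.QuantumFields.YangMills.Cruxes.ContinuumLimitOnTrajectory.JacobianCollapseGronwall

section Smooth

variable {G : Type} [Group G] [TopologicalSpace G] [IsTopologicalGroup G] [CompactSpace G]
  [MeasurableSpace G] [BorelSpace G]

/-- **Every point-split curvature correlator of a finite torus is `C^n` in the coupling**: for all `n : ℕ`, `L`, `s`,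
`β ↦ G2 r β L s = ⟨P ; τ_s P⟩_{β, 2L+1}` is `C^n` on `ℝ` (bounded measurable observables; Literature
`contDiff_integral_wilsonMeasure`, iterated Feynman–Hellmann). -/
theorem contDiff_G2 (r : LatticeRep G) (n L s : ℕ) : ContDiff ℝ n fun β => G2 r β L s := by
  haveI : SecondCountableTopology G :=
    (r.continuous.isClosedEmbedding r.injective).isEmbedding.secondCountableTopology
  obtain ⟨C, hC⟩ := r.curvature.bounded
  have hmeasA : Measurable fun U : GaugeConfig 4 (2 * L + 1) G => r.curvature.F (torusLift (2 * L + 1) U) :=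
    r.curvature.measurable.comp (measurable_torusLift _)
  have hmeasB : Measurable fun U : GaugeConfig 4 (2 * L + 1) G =>
      r.curvature.F (configShift (-Pi.single 0 (s : ℤ)) (torusLift (2 * L + 1) U)) :=
    r.curvature.measurable.comp ((configShift _).measurable.comp (measurable_torusLift _))
  have hbdA : ∀ᵐ U ∂(Measure.pi fun _ : Edge 4 (2 * L + 1) => haarProbability G),
      ‖r.curvature.F (torusLift (2 * L + 1) U)‖ ≤ C :=
    ae_of_all _ fun U => by rw [Real.norm_eq_abs]; exact hC _
  have hbdAB : ∀ᵐ U ∂(Measure.pi fun _ : Edge 4 (2 * L + 1) => haarProbability G),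
      ‖r.curvature.F (torusLift (2 * L + 1) U) *
        r.curvature.F (configShift (-Pi.single 0 (s : ℤ)) (torusLift (2 * L + 1) U))‖ ≤ C * C :=
    ae_of_all _ fun U => by
      rw [norm_mul, Real.norm_eq_abs, Real.norm_eq_abs]
      have hA := hC (torusLift (2 * L + 1) U)
      have hB := hC (configShift (-Pi.single 0 (s : ℤ)) (torusLift (2 * L + 1) U))
      exact mul_le_mul hA hB (abs_nonneg _) ((abs_nonneg _).trans hA)
  have h1 := contDiff_integral_wilsonMeasure (d := 4) (L := 2 * L + 1) (ρ := r.ρ) r.continuous n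
    (hmeasA.mul hmeasB).aestronglyMeasurable hbdAB
  have h2 := contDiff_integral_wilsonMeasure (d := 4) (L := 2 * L + 1) (ρ := r.ρ) r.continuous n
    hmeasA.aestronglyMeasurable hbdA
  simp only [G2, latticeConnectedCorr]
  exact h1.sub (h2.mul h2)

/-- **`CollapseOn.smooth_N` holds for the time-smeared tuning observable**: for a `C²` profile `φ` and every `L`,
`(D, β) ↦ timeSmeared r φ L D β` is `C²` on `{D > 0} × ℝ` (finite sum of products of `D ↦ D⁷ φ(s/D)`, `C²` on `D > 0`,
and `β ↦ G2 r β L s`, `C^∞`). Registered helper of line jacobian-collapse-gronwall. -/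
theorem contDiffOn_timeSmeared :
    ∀ {G : Type} [Group G] [TopologicalSpace G] [IsTopologicalGroup G] [CompactSpace G]
      [MeasurableSpace G] [BorelSpace G] (r : LatticeRep G) {φ : ℝ → ℝ}, ContDiff ℝ 2 φ → ∀ L : ℕ,
      ContDiffOn ℝ 2 (Function.uncurry (timeSmeared r φ L)) (Set.Ioi (0 : ℝ) ×ˢ (Set.univ : Set ℝ)) := by
  intro G _ _ _ _ _ _ r φ hφ L
  have hsum : Function.uncurry (timeSmeared r φ L) = fun p : ℝ × ℝ =>
      ∑ s ∈ Finset.range (L + 1), p.1 ^ 7 * φ ((s : ℝ) / p.1) * G2 r p.2 L s := by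
    funext p; rfl
  rw [hsum]
  refine ContDiffOn.sum fun s _ => ?_
  have h1 : ContDiffOn ℝ 2 (fun p : ℝ × ℝ => p.1 ^ 7) (Set.Ioi (0 : ℝ) ×ˢ (Set.univ : Set ℝ)) :=
    contDiffOn_fst.pow 7
  have h2 : ContDiffOn ℝ 2 (fun p : ℝ × ℝ => φ ((s : ℝ) / p.1)) (Set.Ioi (0 : ℝ) ×ˢ (Set.univ : Set ℝ)) := by
    refine hφ.comp_contDiffOn (contDiffOn_const.div contDiffOn_fst fun p hp => ?_)
    exact (ne_of_gt (Set.mem_prod.1 hp).1)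
  have h3 : ContDiffOn ℝ 2 (fun p : ℝ × ℝ => G2 r p.2 L s) (Set.Ioi (0 : ℝ) ×ˢ (Set.univ : Set ℝ)) :=
    ((contDiff_G2 r 2 L s).comp contDiff_snd).contDiffOn
  exact (h1.mul h2).mul h3

/-- The same for the brancher profile `u ↦ φ(u/2)` (a `C²` profile again): `CollapseOn.smooth_X` for `i = brancher`. -/
theorem contDiffOn_timeSmeared_halve (r : LatticeRep G) {φ : ℝ → ℝ} (hφ : ContDiff ℝ 2 φ) (L : ℕ) :
    ContDiffOn ℝ 2 (Function.uncurry (timeSmeared r (fun u => φ (u / 2)) L))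
      (Set.Ioi (0 : ℝ) ×ˢ (Set.univ : Set ℝ)) :=
  contDiffOn_timeSmeared r (hφ.comp (contDiff_id.div_const 2)) L

end Smooth

end Summit.QuantumFields.YangMills.Cruxes.ContinuumLimitOnTrajectory.JacobianCollapseGronwall

end
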